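import Summits.QuantumFields.BalabanUV.Beta.GAN24.StripRegularBiLocAlgebra
import Literature.MathematicalPhysics.QuantumFieldTheory.Balaban1983to89.Beta.OneStepResolventKernel

/-!
# G-an2-4 ∕ (CONV-C), S-slot: the `LocStencil` ∕ `VertexFamily` PACKAGING of two-momentum fibre readouts — from a
# `u`-UNIFORM joint strip bound to an2's localisation sockets, at fine centres, at block labels, for uniform families and
# for differences (register engine «LOCSTENCIL-PACK*», the generic half of interface I-L7 of `SKELETON-S3.md` v0.3 §8)

G-an2-4 formalisation swarm, leaf prover 20 (unit `b2b-balaban-gan24-formalise-leaf-20`, gen 14), register tag «LOCSTENCIL-PACK*»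
(typer `GAN24/Formal/LEAVES.md` v2.9.2 T-E6 (u1); cell journal INTENT l.4307).  HONEST FRAMING (cell rule, verbatim): «discharging
`BetaPertH` makes Bałaban's UV stability UNCONDITIONAL — a real constructive-QFT result; it is NOT the continuum limit and NOT the
Clay problem.»  HONEST DEPENDENCY (verbatim): «continuum YM on T⁴ ⇐ BetaPertH ∧ nine spine estimates (0/9 proved); BetaPertH ⇐ (D1)
∧ (D4) ∧ CAP+tail; G-an2-4 gates asym, D1 and NE2/3/4.»  NOT IN PRINT; OUR BOOKKEEPING ([folklore]): elementary packaging of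
leaf-14's two-momentum Paley–Wiener engine `GAN24/StripRegularBiLoc` (`norm_latticeKernel₂_le_l1`, `biLoc_of_latticeKernel₂`) into
the localisation predicates of an2's kernel calculus (`ExpKernelCalculus.BiLoc ∕ VertexFamily ∕ VertexFamily₂`,
`OneStepResolventKernel.LocStencil`).  It mentions NO object of an2's typed `U = 1` system (`e3Of`, `Sc`, `vertexOf`, `KInv` do not
occur), computes no symbol, cites nothing, mints no `def … : Prop`, and DISCHARGES NOTHING of the wall's binders (hS, hSall) or of
«E3Shape» ∕ «E3Drift» ∕ «E3SupRate» (OPEN, not in print).  NOT BetaPertH, NOT continuum, NOT Clay.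

WHERE IT SITS (context only, asserted nowhere below).  The row owner's route «S3-fibre²» (`HOME/b2b-balaban-gan24-p1/SKELETON-S3.md`
v0.3 §8) ends in I-L7 `e3Shape_of_symbolBound : (∀ n, ‖E3Sym n …‖ ≤ C₃★ on Strip²) → «E3Shape»`, whose conclusion is
`∃ C₃ δ₃ > 0, ∀ j, LocStencil (…member j+1…) C₃ δ₃`.  The LOCATED half (the symbol `E3Sym` of an2's `e3Of`, its units, its
`n`-uniform strip bound = the crux I-L4) is the owner's; the GENERIC half — «a `(κ′,u)`-indexed kernel family each of whose entries is
(dominated by) a two-momentum lattice kernel of a jointly strip-regular symbol, read at the displacements from its own index `u`, with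
ONE half-width `κ` and ONE bound `M` for all indices, IS a local stencil family with constants depending on `(κ, M, d)` only; the
same for all members of a family at once; the same when the symbol lives on block labels; the same for a difference of two members»
— is this file.  Statement shapes follow the two records drafts the typer named as ready-made: leaf-07-g9
`HOME/…leaf-07/g9/TwoMomentumBiLoc.probe.lean` (§3–§4: `locStencil_of_latticeKernel₂`, `biLoc_of_latticeKernel₂_coarse`) and
leaf-01-g9 `HOME/…leaf-01/g9/BiSymbolDecay.v1.lean` (§3–§4: weight `w`, entry-dependent symbol, affine label distortion `A, B`) —
re-proved here on leaf-14's `latticeKernel₂ ∕ StripRegular (joint ·)` currency (their drafts use private twins `StripRegular₂` ∕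
`biKernel`), credited, not imported (records are not importable).

## What is proved ([folklore], `0 sorry`; lattice `ℤ^{d+1}`, generic `d`, any finite fibre `F` unless `LocStencil` forces `Fib d`;
## throughout `δ(κ) := κ ∕ (2(d+1))` is leaf-14's `ℓ¹` rate)
* §0 SUPPLEMENTS to leaf-14's part 2 (journal l.4271 (b)): `supNorm_pair` (`|(x,y)|_∞ = max(|x|_∞,|y|_∞)`, equality),
  `abs_re_latticeKernel₂_le` (real-part readings in the `ℓ¹` currency).
* §1 PRIMITIVES: `abs_le_of_latticeKernel₂` (a number `≤ w·‖K₂[G](X,Y)‖` is `≤ w·M·e^{−δ(κ)(|X|₁+|Y|₁)}`);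
  `biLoc_of_latticeKernel₂_weighted` (`BiLoc K p q (w·M) δ(κ)` from `|K x y a b| ≤ w·‖K₂[G_{xyab}](x − p, y − q)‖`, the symbol may
  depend on the entry as long as `(κ, M)` do not — e.g. through residues modulo a block).
* §2 `LocStencil`: `locStencil_of_latticeKernel₂` (domination at `(x − u, y − u)`), `locStencil_of_latticeKernel₂'` (the
  `e^{i(p·x − q·y)}` convention, displacements `(x − u, u − y)`), `locStencil_of_re_latticeKernel₂` (readings `c·Re K₂[G]`, `|c| ≤ 1`),
  `locStencil_of_latticeKernel₂_weighted` (weight + entry-dependent symbol).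
* §3 BLOCK LABELS AS CENTRES: `vertexFamily_of_latticeKernel₂` ∕ `vertexFamily₂_of_latticeKernel₂` — families indexed by coarse bonds
  `(μ, y)` with fine legs, read at the displacements from the fine images `N•y` (an2's `VertexFamily V N`, `VertexFamily₂ W N`).
* §4 COARSE-LABEL ADAPTERS: `exp_affine_le`; `biLoc_of_latticeKernel₂_affine` ∕ `locStencil_of_latticeKernel₂_affine` (label maps
  with `|x − p|₁ ≤ A·|X x|₁ + B`: rate `δ(κ)∕A`, constant `w·M·e^{2δ(κ)B∕A}`); the block instances with `LatticeForm.quo L`: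
  `l1_sub_zsmul_le_quo` (`|x − L•u′|₁ ≤ L·|quo L x − u′|₁ + L(d+1)`, = an2's `OneStepResolventKernel.l1_zsmul_sub_le` re-oriented),
  `biLoc_of_latticeKernel₂_block` (symbols in the block-label momenta, as road P1 reads `unitK … (KInvStep Lc j)` through `quo Lc`:
  `BiLoc K (L•u′) (L•v′) (w·M·e^{κ}) (δ(κ)∕L)`), `vertexFamily_of_latticeKernel₂_block`, and for FINE-indexed families read
  through the labels relative to their own index, `l1_sub_le_quo` (`|x − u|₁ ≤ L·|quo L x − quo L u|₁ + 2L(d+1)`) and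
  `locStencil_of_latticeKernel₂_block` (`LocStencil S (w·M·e^{2κ}) (δ(κ)∕L)`).
* §5 UNIFORM FAMILIES (the quantifier shape of «E3Shape», generic; any index type): `locStencil_forall_of_latticeKernel₂`,
  `exists_locStencil_forall_of_latticeKernel₂` (`(κ, M)` free of the member index `n` ⇒ `∃ C δ, 0 < δ ∧ ∀ n, LocStencil (S n) C δ`).
* §6 DIFFERENCES (the generic half of a drift∕Cauchy statement): `biLoc_sub_of_re_latticeKernel₂`, `locStencil_sub_of_re_latticeKernel₂`
  — two kernels read as `c·Re K₂[G]`, `c·Re K₂[G′]` with `StripRegular (joint (G − G′)) κ ε` have `BiLoc (K − K′) p q ε δ(κ)`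
  (leaf-14's `StripRegularBiLocAlgebra.latticeKernel₂_sub`).
* §7 (v1.1): `abs_mul_re_le` (`|c·Re z| ≤ |c|‖z‖`), `biLoc_of_latticeKernel₂_weighted'`, `locStencil_of_latticeKernel₂_weighted'`,
  `exists_locStencil_forall_of_latticeKernel₂_weighted'` — weight + entry-dependent symbol in the `e^{i(p·x − q·y)}` convention
  (displacements `(x − u, u − y)`; the reading of the owner's I-L1, any real weight `cE` through `w = |cE|`).
WHAT IS NOT HERE: any symbol, unit split or strip bound of an2's objects (the owner's I-L1∕I-L3∕I-L4 under `GAN24.StencilSlotE3*`);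
the `unitS` normal form of «E3Shape» (leaf-07-g8's `e3Shape_iff`, records); the sup-rate ⇒ weighted-Cauchy mechanism (owner's
`GAN24/StencilSlotSupRate`).  The rate loss `κ ↦ κ∕(2(d+1))` is leaf-14's (one joint coordinate at a time) and immaterial for the
`∃ δ₃ > 0` form of «E3Shape».
-/

noncomputable section

open Complex
open Literature.MathematicalPhysics.QuantumFieldTheory
open Literature.MathematicalPhysics.QuantumFieldTheory.Balaban1983to89
open Literature.MathematicalPhysics.QuantumFieldTheory.Balaban1983to89.Beta
open B4ContourShift (StripRegular supNorm exists_supNorm_eq abs_le_supNorm)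
open B12Sec2to5 (l1 l1_nonneg)
open ExpKernelCalculus (MKer Site BiLoc VertexFamily VertexFamily₂ l1_sub_symm l1_natSmul l1_sub_triangle)
open OneStepResolventKernel (Fib LocStencil)
open LatticeForm (quo)
open Summit.QuantumFields.BalabanUV.Beta.GAN24.StripRegularRestrict (joint pair inl2 inr2 pair_inl pair_inr inl2_or_inr2)
open Summit.QuantumFields.BalabanUV.Beta.GAN24.StripRegularBiLoc (latticeKernel₂ norm_latticeKernel₂_le_l1 stripRegular_bound_nonneg
  max_supNorm_le_supNorm_pair biLoc_of_latticeKernel₂ biLoc_of_latticeKernel₂' biLoc_of_re_latticeKernel₂)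
open Summit.QuantumFields.BalabanUV.Beta.GAN24.StripRegularBiLocAlgebra (latticeKernel₂_sub)

namespace Summit.QuantumFields.BalabanUV.Beta.GAN24.LocStencilPack

variable {d : ℕ}

/-! ## §0 Two supplements to leaf-14's part 2 (asked for in the cell journal l.4271 (b)) -/

/-- [folklore] `|(x,y)|_∞ = max(|x|_∞, |y|_∞)` — the equality behind leaf-14's `max_supNorm_le_supNorm_pair` (which is the `≤`
the decay uses). -/
theorem supNorm_pair (x y : Fin (d + 1) → ℤ) : supNorm (pair x y) = max (supNorm x) (supNorm y) := by
  refine le_antisymm ?_ (max_supNorm_le_supNorm_pair x y)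
  obtain ⟨l, hl⟩ := exists_supNorm_eq (pair x y)
  rw [hl]
  rcases inl2_or_inr2 l with ⟨i, rfl⟩ | ⟨i, rfl⟩
  · rw [pair_inl]
    exact (abs_le_supNorm x i).trans (le_max_left _ _)
  · rw [pair_inr]
    exact (abs_le_supNorm y i).trans (le_max_right _ _)

/-- [folklore] The REAL PART of a two-momentum kernel in the `ℓ¹` currency:
`|Re latticeKernel₂ G x y| ≤ M·e^{−(κ/(2(d+1)))(|x|₁+|y|₁)}` under `StripRegular (joint G) κ M`, `κ ≥ 0`. -/
theorem abs_re_latticeKernel₂_le {G : ((Fin (d + 1) → ℂ) → (Fin (d + 1) → ℂ) → ℂ)} {κ M : ℝ}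
    (hG : StripRegular (joint G) κ M) (hκ : 0 ≤ κ) (x y : Fin (d + 1) → ℤ) :
    |(latticeKernel₂ G x y).re| ≤ M * Real.exp (-(κ / (2 * (d + 1))) * (l1 x + l1 y)) :=
  (Complex.abs_re_le_norm _).trans (norm_latticeKernel₂_le_l1 hG hκ x y)

/-! ## §1 Primitives: one entry, and `BiLoc` with a weight and an entry-dependent symbol -/

/-- [folklore] POINTWISE PRIMITIVE: a number dominated by `w·‖latticeKernel₂ G X Y‖` for a jointly strip-regular symbol `G`
(half-width `κ ≥ 0`, bound `M`) and a weight `w ≥ 0` is `≤ w·M·e^{−(κ/(2(d+1)))(|X|₁+|Y|₁)}`. -/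
theorem abs_le_of_latticeKernel₂ {G : ((Fin (d + 1) → ℂ) → (Fin (d + 1) → ℂ) → ℂ)} {κ M w k : ℝ}
    (hG : StripRegular (joint G) κ M) (hκ : 0 ≤ κ) (hw : 0 ≤ w)
    {X Y : Fin (d + 1) → ℤ} (hk : |k| ≤ w * ‖latticeKernel₂ G X Y‖) :
    |k| ≤ w * M * Real.exp (-(κ / (2 * (d + 1))) * (l1 X + l1 Y)) := by
  refine hk.trans ?_
  rw [mul_assoc]
  exact mul_le_mul_of_nonneg_left (norm_latticeKernel₂_le_l1 hG hκ X Y) hw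

/-- [folklore] **`BiLoc` WITH A WEIGHT AND AN ENTRY-DEPENDENT SYMBOL**: if every entry `K x y a b` is dominated by `w` times the
two-momentum lattice kernel, read at the displacements from `(p, q)`, of SOME jointly strip-regular symbol with ONE half-width
`κ ≥ 0` and ONE bound `M` (the symbol may vary with the entry — e.g. through residues modulo a block — as long as `κ, M` do not),
then `BiLoc K p q (w·M) (κ/(2(d+1)))`. -/
theorem biLoc_of_latticeKernel₂_weighted {F : Type*} {K : MKer (d + 1) F} {p q : Site (d + 1)} {κ M w : ℝ} (hκ : 0 ≤ κ)
    (hw : 0 ≤ w)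
    (hK : ∀ x y a b, ∃ G : ((Fin (d + 1) → ℂ) → (Fin (d + 1) → ℂ) → ℂ),
      StripRegular (joint G) κ M ∧ |K x y a b| ≤ w * ‖latticeKernel₂ G (x - p) (y - q)‖) :
    BiLoc K p q (w * M) (κ / (2 * (d + 1))) := by
  intro x y a b
  obtain ⟨G, hG, hle⟩ := hK x y a b
  exact abs_le_of_latticeKernel₂ hG hκ hw hle

/-! ## §2 `LocStencil`: `(κ′,u)`-indexed families localised at their own index -/

/-- [folklore] **A STENCIL FAMILY READ OFF TWO-MOMENTUM SYMBOLS IS A LOCAL STENCIL FAMILY**: `S κ′ u` dominated entrywise by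
`‖latticeKernel₂ (G κ′ u a b) (x − u) (y − u)‖` with all symbols jointly strip regular for ONE `(κ, M)`, `κ ≥ 0`
⇒ `LocStencil S M (κ/(2(d+1)))`.  Applied with `(κ, M)` free of a member index it is the member-uniform statement (§5). -/
theorem locStencil_of_latticeKernel₂ {S : Fin (d + 1) → Site (d + 1) → MKer (d + 1) (Fib d)} {κ M : ℝ} (hκ : 0 ≤ κ)
    (G : Fin (d + 1) → Site (d + 1) → Fib d → Fib d → ((Fin (d + 1) → ℂ) → (Fin (d + 1) → ℂ) → ℂ))
    (hG : ∀ κ' u a b, StripRegular (joint (G κ' u a b)) κ M)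
    (hS : ∀ κ' u x y a b, |S κ' u x y a b| ≤ ‖latticeKernel₂ (G κ' u a b) (x - u) (y - u)‖) :
    LocStencil S M (κ / (2 * (d + 1))) :=
  fun κ' u => biLoc_of_latticeKernel₂ hκ (G κ' u) (hG κ' u) (hS κ' u)

/-- [folklore] The same with the second displacement read as `u − y` (the `e^{i(p·x − q·y)}` convention of a sandwich
`row(p) · V̂(p,q) · col(q)` read at `(x − u, y − u)`; `|·|₁` is even). -/
theorem locStencil_of_latticeKernel₂' {S : Fin (d + 1) → Site (d + 1) → MKer (d + 1) (Fib d)} {κ M : ℝ} (hκ : 0 ≤ κ)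
    (G : Fin (d + 1) → Site (d + 1) → Fib d → Fib d → ((Fin (d + 1) → ℂ) → (Fin (d + 1) → ℂ) → ℂ))
    (hG : ∀ κ' u a b, StripRegular (joint (G κ' u a b)) κ M)
    (hS : ∀ κ' u x y a b, |S κ' u x y a b| ≤ ‖latticeKernel₂ (G κ' u a b) (x - u) (u - y)‖) :
    LocStencil S M (κ / (2 * (d + 1))) :=
  fun κ' u => biLoc_of_latticeKernel₂' hκ (G κ' u) (hG κ' u) (hS κ' u)

/-- [folklore] The same with REAL-PART readings `S κ′ u x y a b = c · Re latticeKernel₂ (G κ′ u a b) (x − u) (y − u)`, `|c| ≤ 1`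
(the shape in which road P1 reads its kernels, `CombesThomasFibre.KInv_eq_re_latticeKernel`). -/
theorem locStencil_of_re_latticeKernel₂ {S : Fin (d + 1) → Site (d + 1) → MKer (d + 1) (Fib d)} {κ M c : ℝ} (hκ : 0 ≤ κ)
    (hc : |c| ≤ 1) (G : Fin (d + 1) → Site (d + 1) → Fib d → Fib d → ((Fin (d + 1) → ℂ) → (Fin (d + 1) → ℂ) → ℂ))
    (hG : ∀ κ' u a b, StripRegular (joint (G κ' u a b)) κ M)
    (hS : ∀ κ' u x y a b, S κ' u x y a b = c * (latticeKernel₂ (G κ' u a b) (x - u) (y - u)).re) :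
    LocStencil S M (κ / (2 * (d + 1))) :=
  fun κ' u => biLoc_of_re_latticeKernel₂ hκ hc (G κ' u) (hG κ' u) (hS κ' u)

/-- [folklore] **`LocStencil` WITH A WEIGHT AND AN ENTRY-DEPENDENT SYMBOL** (uniform `(κ, M)`, weight `w ≥ 0`):
`LocStencil S (w·M) (κ/(2(d+1)))`. -/
theorem locStencil_of_latticeKernel₂_weighted {S : Fin (d + 1) → Site (d + 1) → MKer (d + 1) (Fib d)} {κ M w : ℝ}
    (hκ : 0 ≤ κ) (hw : 0 ≤ w)
    (hS : ∀ κ' u x y a b, ∃ G : ((Fin (d + 1) → ℂ) → (Fin (d + 1) → ℂ) → ℂ),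
      StripRegular (joint G) κ M ∧ |S κ' u x y a b| ≤ w * ‖latticeKernel₂ G (x - u) (y - u)‖) :
    LocStencil S (w * M) (κ / (2 * (d + 1))) :=
  fun κ' u => biLoc_of_latticeKernel₂_weighted hκ hw (hS κ' u)

/-! ## §3 Block labels as centres: vertex families at the fine images `N • y` of coarse bonds -/

/-- [folklore] **FIRST-ORDER VERTEX FAMILIES**: a family `V μ y` indexed by coarse bonds `(μ, y)` with fine legs, each entry
dominated by `‖latticeKernel₂ (G μ y a b) (x − N•y) (z − N•y)‖` with uniform `(κ, M)`, is `VertexFamily V N M (κ/(2(d+1)))`. -/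
theorem vertexFamily_of_latticeKernel₂ {F : Type*} [Fintype F] {V : Fin (d + 1) → Site (d + 1) → MKer (d + 1) F} {N : ℕ}
    {κ M : ℝ} (hκ : 0 ≤ κ) (G : Fin (d + 1) → Site (d + 1) → F → F → ((Fin (d + 1) → ℂ) → (Fin (d + 1) → ℂ) → ℂ))
    (hG : ∀ μ y a b, StripRegular (joint (G μ y a b)) κ M)
    (hV : ∀ μ y x z a b, |V μ y x z a b| ≤ ‖latticeKernel₂ (G μ y a b) (x - (N : ℤ) • y) (z - (N : ℤ) • y)‖) :
    VertexFamily V N M (κ / (2 * (d + 1))) :=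
  fun μ y => biLoc_of_latticeKernel₂ hκ (G μ y) (hG μ y) (hV μ y)

/-- [folklore] **SECOND-ORDER VERTEX FAMILIES**: `W μ y ν y′` dominated by
`‖latticeKernel₂ (G μ y ν y′ a b) (x − N•y) (z − N•y′)‖` with uniform `(κ, M)` is `VertexFamily₂ W N M (κ/(2(d+1)))`. -/
theorem vertexFamily₂_of_latticeKernel₂ {F : Type*} [Fintype F]
    {W : Fin (d + 1) → Site (d + 1) → Fin (d + 1) → Site (d + 1) → MKer (d + 1) F} {N : ℕ} {κ M : ℝ} (hκ : 0 ≤ κ)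
    (G : Fin (d + 1) → Site (d + 1) → Fin (d + 1) → Site (d + 1) → F → F → ((Fin (d + 1) → ℂ) → (Fin (d + 1) → ℂ) → ℂ))
    (hG : ∀ μ y ν y' a b, StripRegular (joint (G μ y ν y' a b)) κ M)
    (hW : ∀ μ y ν y' x z a b,
      |W μ y ν y' x z a b| ≤ ‖latticeKernel₂ (G μ y ν y' a b) (x - (N : ℤ) • y) (z - (N : ℤ) • y')‖) :
    VertexFamily₂ W N M (κ / (2 * (d + 1))) :=
  fun μ y ν y' => biLoc_of_latticeKernel₂ hκ (G μ y ν y') (hG μ y ν y') (hW μ y ν y')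

/-- [folklore] Weighted first-order version (entry-dependent symbol, weight `w ≥ 0`): `VertexFamily V N (w·M) (κ/(2(d+1)))`. -/
theorem vertexFamily_of_latticeKernel₂_weighted {F : Type*} [Fintype F] {V : Fin (d + 1) → Site (d + 1) → MKer (d + 1) F}
    {N : ℕ} {κ M w : ℝ} (hκ : 0 ≤ κ) (hw : 0 ≤ w)
    (hV : ∀ μ y x z a b, ∃ G : ((Fin (d + 1) → ℂ) → (Fin (d + 1) → ℂ) → ℂ),
      StripRegular (joint G) κ M ∧ |V μ y x z a b| ≤ w * ‖latticeKernel₂ G (x - (N : ℤ) • y) (z - (N : ℤ) • y)‖) :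
    VertexFamily V N (w * M) (κ / (2 * (d + 1))) :=
  fun μ y => biLoc_of_latticeKernel₂_weighted hκ hw (hV μ y)

/-! ## §4 Coarse-label adapters: symbols on block labels, localisation on the fine lattice -/

/-- [folklore] Exponent bookkeeping: from `a ≤ A·a′ + B`, `b ≤ A·b′ + B` (`A > 0`, `δ ≥ 0`),
`e^{−δ(a′+b′)} ≤ e^{2δB/A} · e^{−(δ/A)(a+b)}`. -/
theorem exp_affine_le {δ A B a b a' b' : ℝ} (hδ : 0 ≤ δ) (hA : 0 < A) (ha : a ≤ A * a' + B) (hb : b ≤ A * b' + B) :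
    Real.exp (-δ * (a' + b')) ≤ Real.exp (2 * δ * B / A) * Real.exp (-(δ / A) * (a + b)) := by
  rw [← Real.exp_add, Real.exp_le_exp]
  have h1 : δ / A * a ≤ δ * a' + δ * B / A := by
    calc δ / A * a ≤ δ / A * (A * a' + B) := mul_le_mul_of_nonneg_left ha (div_nonneg hδ hA.le)
      _ = δ * a' + δ * B / A := by field_simp
  have h2 : δ / A * b ≤ δ * b' + δ * B / A := by
    calc δ / A * b ≤ δ / A * (A * b' + B) := mul_le_mul_of_nonneg_left hb (div_nonneg hδ hA.le)
      _ = δ * b' + δ * B / A := by field_simp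
  have h3 : 2 * δ * B / A = δ * B / A + δ * B / A := by ring
  rw [h3]
  nlinarith

/-- [folklore] **AFFINE-LABEL ADAPTER ⇒ `BiLoc`**: if each entry `K x y a b` is dominated by `w·‖latticeKernel₂ G (X x) (Y y)‖` for
some jointly strip-regular symbol `G` (uniform `κ ≥ 0`, `M`), where the label maps satisfy `|x − p|₁ ≤ A·|X x|₁ + B` and
`|y − q|₁ ≤ A·|Y y|₁ + B` (`A > 0`), then `BiLoc K p q (w·M·e^{2δB/A}) (δ/A)` with `δ = κ/(2(d+1))`. -/
theorem biLoc_of_latticeKernel₂_affine {F : Type*} {K : MKer (d + 1) F} {p q : Site (d + 1)} {κ M w A B : ℝ}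
    (hκ : 0 ≤ κ) (hw : 0 ≤ w) (hA : 0 < A) (X Y : Site (d + 1) → (Fin (d + 1) → ℤ))
    (hX : ∀ x, l1 (x - p) ≤ A * l1 (X x) + B) (hY : ∀ y, l1 (y - q) ≤ A * l1 (Y y) + B)
    (hK : ∀ x y a b, ∃ G : ((Fin (d + 1) → ℂ) → (Fin (d + 1) → ℂ) → ℂ),
      StripRegular (joint G) κ M ∧ |K x y a b| ≤ w * ‖latticeKernel₂ G (X x) (Y y)‖) :
    BiLoc K p q (w * M * Real.exp (2 * (κ / (2 * (d + 1))) * B / A)) (κ / (2 * (d + 1)) / A) := by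
  intro x y a b
  obtain ⟨G, hG, hle⟩ := hK x y a b
  have h1 := abs_le_of_latticeKernel₂ hG hκ hw hle
  have hwM : 0 ≤ w * M := mul_nonneg hw (stripRegular_bound_nonneg hG hκ)
  have hδ : 0 ≤ κ / (2 * (d + 1)) := div_nonneg hκ (by positivity)
  have h2 := exp_affine_le hδ hA (hX x) (hY y)
  calc |K x y a b| ≤ w * M * Real.exp (-(κ / (2 * (d + 1))) * (l1 (X x) + l1 (Y y))) := h1
    _ ≤ w * M * (Real.exp (2 * (κ / (2 * (d + 1))) * B / A) *
          Real.exp (-(κ / (2 * (d + 1)) / A) * (l1 (x - p) + l1 (y - q)))) :=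
        mul_le_mul_of_nonneg_left h2 hwM
    _ = w * M * Real.exp (2 * (κ / (2 * (d + 1))) * B / A) *
          Real.exp (-(κ / (2 * (d + 1)) / A) * (l1 (x - p) + l1 (y - q))) := by ring

/-- [folklore] **AFFINE-LABEL ADAPTER ⇒ `LocStencil`** (label maps `X u`, `Y u` relative to the localisation point `u`). -/
theorem locStencil_of_latticeKernel₂_affine {S : Fin (d + 1) → Site (d + 1) → MKer (d + 1) (Fib d)} {κ M w A B : ℝ}
    (hκ : 0 ≤ κ) (hw : 0 ≤ w) (hA : 0 < A) (X Y : Site (d + 1) → Site (d + 1) → (Fin (d + 1) → ℤ))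
    (hX : ∀ u x, l1 (x - u) ≤ A * l1 (X u x) + B) (hY : ∀ u y, l1 (y - u) ≤ A * l1 (Y u y) + B)
    (hS : ∀ κ' u x y a b, ∃ G : ((Fin (d + 1) → ℂ) → (Fin (d + 1) → ℂ) → ℂ),
      StripRegular (joint G) κ M ∧ |S κ' u x y a b| ≤ w * ‖latticeKernel₂ G (X u x) (Y u y)‖) :
    LocStencil S (w * M * Real.exp (2 * (κ / (2 * (d + 1))) * B / A)) (κ / (2 * (d + 1)) / A) :=
  fun κ' u => biLoc_of_latticeKernel₂_affine hκ hw hA (X u) (Y u) (hX u) (hY u) (hS κ' u)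

/-- [folklore] BLOCK GEOMETRY: `|x − L•u′|₁ ≤ L·|quo L x − u′|₁ + L(d+1)` (an2's `OneStepResolventKernel.l1_zsmul_sub_le`,
re-oriented by `|·|₁`-evenness). -/
theorem l1_sub_zsmul_le_quo (L : ℕ) [NeZero L] (x u' : Site (d + 1)) :
    l1 (x - (L : ℤ) • u') ≤ (L : ℝ) * l1 (quo L x - u') + (L : ℝ) * (d + 1) := by
  rw [l1_sub_symm x, l1_sub_symm (quo L x)]
  exact OneStepResolventKernel.l1_zsmul_sub_le (N := L) u' x

/-- [folklore] **BLOCK-LABEL SYMBOLS ⇒ `BiLoc` AT COARSE POINTS**: if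
`|K x z a b| ≤ w·‖latticeKernel₂ G (quo L x − u′) (quo L z − v′)‖`
(two-momentum kernels in the block-label momenta, as road P1 reads `unitK … (KInvStep Lc j)` through `quo Lc`) with all symbols
jointly strip regular for ONE `(κ, M)`, `κ ≥ 0`, then on the fine lattice `BiLoc K (L•u′) (L•v′) (w·M·e^{κ}) (κ/(2(d+1))/L)`. -/
theorem biLoc_of_latticeKernel₂_block {F : Type*} {L : ℕ} [NeZero L] {K : MKer (d + 1) F} {u' v' : Site (d + 1)}
    {κ M w : ℝ} (hκ : 0 ≤ κ) (hw : 0 ≤ w)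
    (hK : ∀ x z a b, ∃ G : ((Fin (d + 1) → ℂ) → (Fin (d + 1) → ℂ) → ℂ),
      StripRegular (joint G) κ M ∧ |K x z a b| ≤ w * ‖latticeKernel₂ G (quo L x - u') (quo L z - v')‖) :
    BiLoc K ((L : ℤ) • u') ((L : ℤ) • v') (w * M * Real.exp κ) (κ / (2 * (d + 1)) / L) := by
  have hL : (0 : ℝ) < L := by exact_mod_cast Nat.pos_of_ne_zero (NeZero.ne L)
  have h := biLoc_of_latticeKernel₂_affine (K := K) (p := (L : ℤ) • u') (q := (L : ℤ) • v') (B := (L : ℝ) * (d + 1)) hκ hw hL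
    (fun x => quo L x - u') (fun z => quo L z - v') (fun x => l1_sub_zsmul_le_quo L x u') (fun z => l1_sub_zsmul_le_quo L z v') hK
  have hexp : 2 * (κ / (2 * (d + 1))) * ((L : ℝ) * (d + 1)) / L = κ := by
    field_simp
  rwa [hexp] at h

/-- [folklore] **BLOCK-LABEL SYMBOLS ⇒ `VertexFamily`**: a coarse-bond-indexed family `V μ y` with
`|V μ y x z a b| ≤ w·‖latticeKernel₂ G (quo L x − y) (quo L z − y)‖` (uniform `(κ, M)`) is
`VertexFamily V L (w·M·e^{κ}) (κ/(2(d+1))/L)`. -/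
theorem vertexFamily_of_latticeKernel₂_block {F : Type*} [Fintype F] {L : ℕ} [NeZero L]
    {V : Fin (d + 1) → Site (d + 1) → MKer (d + 1) F} {κ M w : ℝ} (hκ : 0 ≤ κ) (hw : 0 ≤ w)
    (hV : ∀ μ y x z a b, ∃ G : ((Fin (d + 1) → ℂ) → (Fin (d + 1) → ℂ) → ℂ),
      StripRegular (joint G) κ M ∧ |V μ y x z a b| ≤ w * ‖latticeKernel₂ G (quo L x - y) (quo L z - y)‖) :
    VertexFamily V L (w * M * Real.exp κ) (κ / (2 * (d + 1)) / L) :=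
  fun μ y => biLoc_of_latticeKernel₂_block hκ hw (hV μ y)

/-- [folklore] BLOCK GEOMETRY between two fine points through their block labels:
`|x − u|₁ ≤ L·|quo L x − quo L u|₁ + 2L(d+1)` (road P1's `CombesThomasFibreStep.l1_sub_le_coarse` shape). -/
theorem l1_sub_le_quo (L : ℕ) [NeZero L] (x u : Site (d + 1)) :
    l1 (x - u) ≤ (L : ℝ) * l1 (quo L x - quo L u) + 2 * ((L : ℝ) * (d + 1)) := by
  have h1 := l1_sub_zsmul_le_quo L x (quo L u)
  have h2 : l1 ((L : ℤ) • quo L u - u) ≤ (L : ℝ) * (d + 1) := by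
    have h := OneStepResolventKernel.l1_zsmul_sub_le (N := L) (quo L u) u
    have h0 : l1 (quo L u - quo L u) = 0 := by rw [sub_self]; simp [l1]
    rw [h0, mul_zero, zero_add] at h
    exact h
  have h3 := l1_sub_triangle x ((L : ℤ) • quo L u) u
  linarith

/-- [folklore] **BLOCK-LABEL SYMBOLS ⇒ `LocStencil`** for a FINE-bond-indexed family whose symbols live on the block labels relative
to the label of its own index: `|S κ′ u x y a b| ≤ w·‖latticeKernel₂ G (quo L x − quo L u) (quo L y − quo L u)‖` (uniform `(κ, M)`)
⇒ `LocStencil S (w·M·e^{2κ}) (κ/(2(d+1))/L)`. -/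
theorem locStencil_of_latticeKernel₂_block {L : ℕ} [NeZero L] {S : Fin (d + 1) → Site (d + 1) → MKer (d + 1) (Fib d)}
    {κ M w : ℝ} (hκ : 0 ≤ κ) (hw : 0 ≤ w)
    (hS : ∀ κ' u x y a b, ∃ G : ((Fin (d + 1) → ℂ) → (Fin (d + 1) → ℂ) → ℂ), StripRegular (joint G) κ M ∧
      |S κ' u x y a b| ≤ w * ‖latticeKernel₂ G (quo L x - quo L u) (quo L y - quo L u)‖) :
    LocStencil S (w * M * Real.exp (2 * κ)) (κ / (2 * (d + 1)) / L) := by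
  have hL : (0 : ℝ) < L := by exact_mod_cast Nat.pos_of_ne_zero (NeZero.ne L)
  have h := locStencil_of_latticeKernel₂_affine (S := S) (B := 2 * ((L : ℝ) * (d + 1))) hκ hw hL
    (fun u x => quo L x - quo L u) (fun u y => quo L y - quo L u) (fun u x => l1_sub_le_quo L x u)
    (fun u y => l1_sub_le_quo L y u) hS
  have hexp : 2 * (κ / (2 * (d + 1))) * (2 * ((L : ℝ) * (d + 1))) / L = 2 * κ := by
    field_simp
  rwa [hexp] at h

/-! ## §5 Uniform families: one `(κ, M)` for every member (the quantifier shape of «E3Shape», generic) -/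

/-- [folklore] **MEMBER-UNIFORM `LocStencil`**: a family of stencil families `S n` (any index type — e.g. the member index of a
renormalisation-group sequence) all read off jointly strip-regular two-momentum symbols with ONE `(κ, M)` satisfies
`LocStencil (S n) M (κ/(2(d+1)))` for EVERY `n` — same constant, same rate. -/
theorem locStencil_forall_of_latticeKernel₂ {ι : Type*} {S : ι → Fin (d + 1) → Site (d + 1) → MKer (d + 1) (Fib d)} {κ M : ℝ}
    (hκ : 0 ≤ κ) (G : ι → Fin (d + 1) → Site (d + 1) → Fib d → Fib d → ((Fin (d + 1) → ℂ) → (Fin (d + 1) → ℂ) → ℂ))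
    (hG : ∀ n κ' u a b, StripRegular (joint (G n κ' u a b)) κ M)
    (hS : ∀ n κ' u x y a b, |S n κ' u x y a b| ≤ ‖latticeKernel₂ (G n κ' u a b) (x - u) (y - u)‖) :
    ∀ n, LocStencil (S n) M (κ / (2 * (d + 1))) :=
  fun n => locStencil_of_latticeKernel₂ hκ (G n) (hG n) (hS n)

/-- [folklore] The same in the `∃ C δ, 0 < δ ∧ ∀ n, LocStencil (S n) C δ` form (needs `κ > 0`), with the weighted ∕
entry-dependent-symbol hypothesis. -/
theorem exists_locStencil_forall_of_latticeKernel₂ {ι : Type*} {S : ι → Fin (d + 1) → Site (d + 1) → MKer (d + 1) (Fib d)}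
    {κ M w : ℝ}
    (hκ : 0 < κ) (hw : 0 ≤ w)
    (hS : ∀ n κ' u x y a b, ∃ G : ((Fin (d + 1) → ℂ) → (Fin (d + 1) → ℂ) → ℂ),
      StripRegular (joint G) κ M ∧ |S n κ' u x y a b| ≤ w * ‖latticeKernel₂ G (x - u) (y - u)‖) :
    ∃ C δ : ℝ, 0 < δ ∧ ∀ n, LocStencil (S n) C δ :=
  ⟨w * M, κ / (2 * (d + 1)), div_pos hκ (by positivity), fun n => locStencil_of_latticeKernel₂_weighted hκ.le hw (hS n)⟩

/-! ## §6 Differences: the generic half of a drift ∕ Cauchy statement -/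

/-- [folklore] **DIFFERENCE OF TWO READOUTS**: kernels `K`, `K′` read as `c·Re latticeKernel₂ (G a b)` resp. `c·Re latticeKernel₂ (G′ a b)`
at the displacements from `(p, q)` (`|c| ≤ 1`), with `G`, `G′` jointly strip regular of half-width `κ ≥ 0` (any bounds) and the
DIFFERENCE symbol bounded by `ε` on the joint strip, have `BiLoc (K − K′) p q ε (κ/(2(d+1)))`. -/
theorem biLoc_sub_of_re_latticeKernel₂ {F : Type*} [Fintype F] {K K' : MKer (d + 1) F} {p q : Site (d + 1)}
    {κ M M' ε c : ℝ} (hκ : 0 ≤ κ) (hc : |c| ≤ 1) (G G' : F → F → ((Fin (d + 1) → ℂ) → (Fin (d + 1) → ℂ) → ℂ))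
    (hG : ∀ a b, StripRegular (joint (G a b)) κ M) (hG' : ∀ a b, StripRegular (joint (G' a b)) κ M')
    (hD : ∀ a b, StripRegular (joint fun P Q => G a b P Q - G' a b P Q) κ ε)
    (hK : ∀ x y a b, K x y a b = c * (latticeKernel₂ (G a b) (x - p) (y - q)).re)
    (hK' : ∀ x y a b, K' x y a b = c * (latticeKernel₂ (G' a b) (x - p) (y - q)).re) :
    BiLoc (K - K') p q ε (κ / (2 * (d + 1))) := by
  refine biLoc_of_re_latticeKernel₂ hκ hc (fun a b P Q => G a b P Q - G' a b P Q) hD fun x y a b => ?_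
  show K x y a b - K' x y a b = _
  rw [hK, hK', latticeKernel₂_sub (hG a b) (hG' a b) hκ, Complex.sub_re]
  ring

/-- [folklore] **DIFFERENCE OF TWO MEMBERS OF A STENCIL FAMILY**: `S`, `S′` read as `c·Re latticeKernel₂` of symbols `G κ′ u a b`,
`G′ κ′ u a b` with the difference symbols bounded by `ε` on the joint strip ⇒ `LocStencil (S − S′) ε (κ/(2(d+1)))` (pointwise
difference of the families). -/
theorem locStencil_sub_of_re_latticeKernel₂ {S S' : Fin (d + 1) → Site (d + 1) → MKer (d + 1) (Fib d)} {κ M M' ε c : ℝ}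
    (hκ : 0 ≤ κ) (hc : |c| ≤ 1)
    (G G' : Fin (d + 1) → Site (d + 1) → Fib d → Fib d → ((Fin (d + 1) → ℂ) → (Fin (d + 1) → ℂ) → ℂ))
    (hG : ∀ κ' u a b, StripRegular (joint (G κ' u a b)) κ M) (hG' : ∀ κ' u a b, StripRegular (joint (G' κ' u a b)) κ M')
    (hD : ∀ κ' u a b, StripRegular (joint fun P Q => G κ' u a b P Q - G' κ' u a b P Q) κ ε)
    (hS : ∀ κ' u x y a b, S κ' u x y a b = c * (latticeKernel₂ (G κ' u a b) (x - u) (y - u)).re)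
    (hS' : ∀ κ' u x y a b, S' κ' u x y a b = c * (latticeKernel₂ (G' κ' u a b) (x - u) (y - u)).re) :
    LocStencil (S - S') ε (κ / (2 * (d + 1))) :=
  fun κ' u => biLoc_sub_of_re_latticeKernel₂ hκ hc (G κ' u) (G' κ' u) (hG κ' u) (hG' κ' u) (hD κ' u) (hS κ' u) (hS' κ' u)

/-! ## §7 (v1.1, APPEND-ONLY) The `e^{i(p·x − q·y)}` convention with a weight and an entry-dependent symbol (I-L1's shape) -/

/-- [folklore] Bridge from exact `c·Re` readings to domination: `|c · Re z| ≤ |c|·‖z‖`. -/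
theorem abs_mul_re_le (c : ℝ) (z : ℂ) : |c * z.re| ≤ |c| * ‖z‖ := by
  rw [abs_mul]
  exact mul_le_mul_of_nonneg_left (Complex.abs_re_le_norm z) (abs_nonneg c)

/-- [folklore] `BiLoc K p q (w·M) (κ/(2(d+1)))` from `|K x y a b| ≤ w·‖latticeKernel₂ G (x − p) (q − y)‖`, SOME jointly
strip-regular `G` per entry (uniform `(κ, M)`; `w ≥ 0`, e.g. `|cE|` via `abs_mul_re_le`; zero blocks: any `G`). -/
theorem biLoc_of_latticeKernel₂_weighted' {F : Type*} {K : MKer (d + 1) F} {p q : Site (d + 1)} {κ M w : ℝ}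
    (hκ : 0 ≤ κ) (hw : 0 ≤ w) (hK : ∀ x y a b, ∃ G : ((Fin (d + 1) → ℂ) → (Fin (d + 1) → ℂ) → ℂ),
      StripRegular (joint G) κ M ∧ |K x y a b| ≤ w * ‖latticeKernel₂ G (x - p) (q - y)‖) :
    BiLoc K p q (w * M) (κ / (2 * (d + 1))) := by
  intro x y a b
  obtain ⟨G, hG, hle⟩ := hK x y a b
  have h := abs_le_of_latticeKernel₂ hG hκ hw hle
  rwa [l1_sub_symm q y] at h

/-- [folklore] `LocStencil S (w·M) (κ/(2(d+1)))` from `|S κ′ u x y a b| ≤ w·‖latticeKernel₂ G (x − u) (u − y)‖` (∃ `G` per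
entry, uniform `(κ, M)`) — the reading of I-L1 (`M^{2(d+1)}·e3Of = Re ∫∫ e^{i(p·(x′−u′) − p′·(z′−u′))} E3Sym`) after `abs_mul_re_le`. -/
theorem locStencil_of_latticeKernel₂_weighted' {S : Fin (d + 1) → Site (d + 1) → MKer (d + 1) (Fib d)} {κ M w : ℝ}
    (hκ : 0 ≤ κ) (hw : 0 ≤ w) (hS : ∀ κ' u x y a b, ∃ G : ((Fin (d + 1) → ℂ) → (Fin (d + 1) → ℂ) → ℂ),
      StripRegular (joint G) κ M ∧ |S κ' u x y a b| ≤ w * ‖latticeKernel₂ G (x - u) (u - y)‖) :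
    LocStencil S (w * M) (κ / (2 * (d + 1))) :=
  fun κ' u => biLoc_of_latticeKernel₂_weighted' hκ hw (hS κ' u)

/-- [folklore] MEMBER-UNIFORM primed version, «E3Shape»'s quantifier shape (`κ > 0`, any index type): one `(κ, M, w)` for all
`n` ⇒ `∃ C δ, 0 < δ ∧ ∀ n, LocStencil (S n) C δ` — the generic half of I-L7 `e3Shape_of_symbolBound`. -/
theorem exists_locStencil_forall_of_latticeKernel₂_weighted' {ι : Type*}
    {S : ι → Fin (d + 1) → Site (d + 1) → MKer (d + 1) (Fib d)} {κ M w : ℝ} (hκ : 0 < κ) (hw : 0 ≤ w)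
    (hS : ∀ n κ' u x y a b, ∃ G : ((Fin (d + 1) → ℂ) → (Fin (d + 1) → ℂ) → ℂ),
      StripRegular (joint G) κ M ∧ |S n κ' u x y a b| ≤ w * ‖latticeKernel₂ G (x - u) (u - y)‖) :
    ∃ C δ : ℝ, 0 < δ ∧ ∀ n, LocStencil (S n) C δ :=
  ⟨w * M, κ / (2 * (d + 1)), div_pos hκ (by positivity), fun n => locStencil_of_latticeKernel₂_weighted' hκ.le hw (hS n)⟩

end Summit.QuantumFields.BalabanUV.Beta.GAN24.LocStencilPack
end
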